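import Literature.AlgebraicGeometry.Frobenioids.IsotropicSubcategory
import Literature.AlgebraicGeometry.Frobenioids.PreFrobenioidPullbacks
import HarnessLib

/-!
# Frobenioids I, Proposition 1.9 (v), part 2: `C^istr` is a Frobenioid

Mochizuki, *The geometry of Frobenioids I: the general theory*, Kyushu J. Math. **62** (2008)
293–400, §1, Proposition 1.9 (v) and its proof, kurims text pp. 32–33
[cite: MochizukiFrdI2008, Prop. 1.9(v)]:

> "(v) `C^istr` [equipped with the restriction to `C^istr` of the given functor `C → F_Φ`] is a
> Frobenioid."

PROVED: "By applying the definition of an isotropic hull [cf. Definition 1.2, (iv)], it follows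
immediately [from the fact that `C` is connected and totally epimorphic] that `C^istr` is connected
and totally epimorphic. Thus, `C^istr` is a pre-Frobenioid. … Finally, in light of Proposition
1.4, (i); assertion (iv) [cf. also Definition 1.3, (vii), (b)], it follows immediately [from the
fact that `C` is a Frobenioid!] that the pre-Frobenioid `C^istr` satisfies the various conditions
of Definition 1.3" (p. 33). Each clause of Def. 1.3 is transported along the compatibilities of
`IsotropicSubcategory.lean`; objects produced by the clauses for `C` are isotropic by
Def. 1.3 (vii)(b) or Prop. 1.9 (iv), or are replaced by their isotropic hulls (Def. 1.3 (i)(a),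
(i)(b), connectedness). The isotropification functor is in `Isotropification.lean`.
No statement of the paper is strengthened.
-/

namespace Literature.AlgebraicGeometry.Frobenioids

open CategoryTheory Opposite

universe w v v' u u'

namespace PreFrobenioid

variable {D : Type u} [Category.{v} D] {Φ : Dᵒᵖ ⥤ CommMonCat.{w}}
  {C : Type u'} [Category.{v'} C] {F : C ⥤ ElemFrobenioid Φ}

/-! ### Chosen isotropic hulls -/

/-- A chosen isotropic hull object of `Z` (Def. 1.3 (vii)(a)). [cite: MochizukiFrdI2008, Def. 1.3(vii)] -/
noncomputable def hullObj (hF : IsFrobenioid F) (Z : C) : C := (hF.vii_a Z).choose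

/-- The chosen isotropic hull `Z → Z^istr`. [cite: MochizukiFrdI2008, Def. 1.3(vii)] -/
noncomputable def hullHom (hF : IsFrobenioid F) (Z : C) : Z ⟶ hullObj hF Z :=
  (hF.vii_a Z).choose_spec.choose

/-- The chosen hull is an isotropic hull. [cite: MochizukiFrdI2008, Def. 1.3(vii)] -/
theorem isIsotropicHull_hullHom (hF : IsFrobenioid F) (Z : C) : IsIsotropicHull F (hullHom hF Z) :=
  (hF.vii_a Z).choose_spec.choose_spec

/-- The chosen hull as an object of `C^istr`. [cite: MochizukiFrdI2008, Def. 1.3(vii)] -/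
noncomputable def hullIstr (hF : IsFrobenioid F) (Z : C) : Istr F :=
  Istr.mk (hullObj hF Z) (isIsotropicHull_hullHom hF Z).2.2.1

/-! ### `C^istr` is a pre-Frobenioid -/

/-- `C^istr` is totally epimorphic (the inclusion is faithful). [cite: MochizukiFrdI2008, Prop. 1.9(v) p.33] -/
theorem isTotallyEpimorphic_istr (hP : IsPreFrobenioid Φ F) : IsTotallyEpimorphic (Istr F) := by
  refine ⟨fun f => ⟨fun g h hgh => ?_⟩⟩
  haveI := hP.isTotallyEpimorphic.epi f.hom
  apply ObjectProperty.hom_ext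
  exact (cancel_epi f.hom).mp (congrArg InducedCategory.Hom.hom hgh)

/-- An arrow `Z₁ → Z₂` induces an arrow of `C^istr` between the chosen hulls (universal property of
the hull of `Z₁`). [cite: MochizukiFrdI2008, Prop. 1.9(v) p.33] -/
theorem nonempty_hom_hullIstr (hF : IsFrobenioid F) {Z₁ Z₂ : C} (a : Z₁ ⟶ Z₂) :
    Nonempty (hullIstr hF Z₁ ⟶ hullIstr hF Z₂) := by
  obtain ⟨a', -, -⟩ := (isIsotropicHull_hullHom hF Z₁).2.2.2 (a ≫ hullHom hF Z₂)
    (isIsotropicHull_hullHom hF Z₂).2.2.1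
  exact ⟨ObjectProperty.homMk a'⟩

/-- `C^istr` is connected ("by applying the definition of an isotropic hull … from the fact that
`C` is connected"): transport a zigzag of `C` to the chosen hulls.
[cite: MochizukiFrdI2008, Prop. 1.9(v) p.33] -/
theorem isGraphConnected_istr (hF : IsFrobenioid F) : IsGraphConnected (Istr F) := by
  have hconn := hF.isPreFrobenioid.isGraphConnected
  obtain ⟨⟨Z₀⟩, hz⟩ := hconn
  -- every object of `C^istr` is connected to the chosen hull of any object of `C`
  have key : ∀ (X : Istr F) (Z : C), Zigzag X.obj Z → Zigzag X (hullIstr hF Z) := by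
    intro X Z h
    induction h with
    | refl =>
      obtain ⟨e, -, -⟩ := (isIsotropicHull_hullHom hF X.obj).2.2.2 (𝟙 X.obj) X.property
      exact Zigzag.of_inv (ObjectProperty.homMk e : hullIstr hF X.obj ⟶ X)
    | tail _ hbc ih =>
      rcases hbc with ⟨⟨a⟩⟩ | ⟨⟨a⟩⟩
      · exact ih.trans (Zigzag.of_hom (nonempty_hom_hullIstr hF a).some)
      · exact ih.trans (Zigzag.of_inv (nonempty_hom_hullIstr hF a).some)
  refine ⟨⟨hullIstr hF Z₀⟩, fun X Y => ?_⟩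
  obtain ⟨e, -, -⟩ := (isIsotropicHull_hullHom hF Y.obj).2.2.2 (𝟙 Y.obj) Y.property
  exact (key X Y.obj (hz X.obj Y.obj)).trans
    (Zigzag.of_hom (ObjectProperty.homMk e : hullIstr hF Y.obj ⟶ Y))

/-- **Prop. 1.9 (v)**, first step: "Thus, `C^istr` is a pre-Frobenioid."
[cite: MochizukiFrdI2008, Prop. 1.9(v) p.33] -/
theorem isPreFrobenioid_istr (hF : IsFrobenioid F) : IsPreFrobenioid Φ (istrFunctor F) where
  isMonoidOn := hF.isPreFrobenioid.isMonoidOn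
  isDivisorial := hF.isPreFrobenioid.isDivisorial
  isGraphConnected_base := hF.isPreFrobenioid.isGraphConnected_base
  isTotallyEpimorphic_base := hF.isPreFrobenioid.isTotallyEpimorphic_base
  isGraphConnected := isGraphConnected_istr hF
  isTotallyEpimorphic := isTotallyEpimorphic_istr hF.isPreFrobenioid

/-! ### Transport of structure along hulls and along the inclusion -/

/-- Frobenius-triviality passes to an isotropic hull: the base-identity endomorphisms of
Frobenius type `ζ(n)` of `A` descend uniquely along the hull `h : A → A'`.
[cite: MochizukiFrdI2008, Prop. 1.9(v) p.33] -/
theorem isFrobeniusTrivial_hull (hF : IsFrobenioid F) {A A' : C} {h : A ⟶ A'}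
    (hh : IsIsotropicHull F h) (hA : IsFrobeniusTrivial F A) : IsFrobeniusTrivial F A' := by
  have hP := hF.isPreFrobenioid
  haveI := hP.isTotallyEpimorphic.epi h
  haveI : IsIso (Base F h) := hh.2.1.2
  obtain ⟨ζ, hζ⟩ := hA
  have hex : ∀ n : ℕ+, ∃! e : A' ⟶ A', h ≫ e = (ζ n : A ⟶ A) ≫ h :=
    fun n => hh.2.2.2 ((ζ n : A ⟶ A) ≫ h) hh.2.2.1
  choose e he heu using hex
  have he1 : e 1 = 𝟙 A' := by
    symm; apply heu; rw [map_one, End.one_def, Category.id_comp, Category.comp_id]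
  have hemul : ∀ m n, e (m * n) = e n ≫ e m := by
    intro m n; symm; apply heu
    rw [map_mul, End.mul_def, ← Category.assoc, he n, Category.assoc, he m, Category.assoc]
  let ζ' : ℕ+ →* End A' := { toFun := e, map_one' := he1, map_mul' := hemul }
  refine ⟨ζ', fun n => ?_⟩
  obtain ⟨hd, hb, hft⟩ := hζ n
  have hb' : IsBaseIdentity F (e n) := by
    have := congrArg (Base F) (he n)
    rw [base_comp, base_comp, show Base F (ζ n : A ⟶ A) = 𝟙 _ from hb, Category.id_comp] at this
    have this' : Base F h ≫ Base F (e n) = Base F h ≫ 𝟙 _ := by rw [this, Category.comp_id]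
    exact (cancel_epi (Base F h)).mp this'
  have hdeg : degFr F (e n) = n := by
    have := congrArg (degFr F) (he n)
    rw [degFr_comp, degFr_comp, hd, show degFr F h = 1 from hh.2.1.1, one_mul, mul_one] at this
    exact this
  have hiso : IsIsometry F (e n) := by
    have := congrArg (Div F) (he n)
    rw [div_comp, div_comp, show Div F h = 1 from hh.1, one_pow, mul_one, map_one, one_mul,
      show Div F (ζ n : A ⟶ A) = 1 from hft.1.2, one_pow] at this
    exact (hP.isMonoidOn.isCharInjective (Base F h)).1 (by rw [this, map_one])
  refine ⟨hdeg, hb', ⟨⟨isCoAngular_endo F hF (e n), hiso⟩, ?_⟩⟩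
  show IsIso (Base F (e n))
  rw [show Base F (e n) = 𝟙 _ from hb']
  infer_instance

/-- `End`omorphisms of an object of `C^istr` lying in `O^▷` are those of the underlying object:
`O^▷(A)` for `C^istr` is `O^▷(A)` for `C`. [cite: MochizukiFrdI2008, Prop. 1.9(v) p.32] -/
def endSubmonoidIstrEquiv (A : Istr F) : endSubmonoid (istrFunctor F) A ≃* endSubmonoid F A.obj where
  toFun a := ⟨a.1.hom, a.2⟩
  invFun b := ⟨ObjectProperty.homMk b.1, b.2⟩
  left_inv _ := rfl
  right_inv _ := rfl
  map_mul' _ _ := rfl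

/-- Frobenius-triviality is compatible with the inclusion `C^istr ↪ C`.
[cite: MochizukiFrdI2008, Prop. 1.9(v) p.32] -/
theorem isFrobeniusTrivial_istr_iff (hF : IsFrobenioid F) (A : Istr F) :
    IsFrobeniusTrivial (istrFunctor F) A ↔ IsFrobeniusTrivial F A.obj := by
  constructor
  · rintro ⟨ζ, hζ⟩
    let ι : End A →* End A.obj :=
      { toFun := fun a => a.hom, map_one' := rfl, map_mul' := fun _ _ => rfl }
    refine ⟨ι.comp ζ, fun n => ⟨(hζ n).1, (hζ n).2.1, ?_⟩⟩
    exact (isFrobeniusType_istr_iff hF (ζ n)).mp (hζ n).2.2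
  · rintro ⟨ζ, hζ⟩
    let ι : End A.obj →* End A :=
      { toFun := fun a => ObjectProperty.homMk a, map_one' := rfl, map_mul' := fun _ _ => rfl }
    refine ⟨ι.comp ζ, fun n => ⟨(hζ n).1, (hζ n).2.1, ?_⟩⟩
    exact (isFrobeniusType_istr_iff hF _).mpr (hζ n).2.2

/-! ### `C^istr` is a Frobenioid -/

/-- **Prop. 1.9 (v)**: `C^istr`, with the restriction of `C → F_Φ`, is a Frobenioid.
[cite: MochizukiFrdI2008, Prop. 1.9(v) p.32] -/
theorem isFrobenioid_istr (hF : IsFrobenioid F) : IsFrobenioid (istrFunctor F) := by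
  have hP := hF.isPreFrobenioid
  have hC := hP.isTotallyEpimorphic
  refine
    { isPreFrobenioid := isPreFrobenioid_istr hF
      i_a := ?_, i_b := ?_, i_c := ?_, ii_exists := ?_, ii_unique := ?_, iii_a := ?_, iii_b := ?_,
      iii_c := ?_, iii_c_base := ?_, iii_d_under_full := ?_, iii_d_under_surj := ?_,
      iii_d_over_full := ?_, iii_d_over_surj := ?_, iv_a_exists := ?_, iv_a_unique := ?_, iv_b := ?_,
      v_a := ?_, v_b_exists := ?_, v_b_unique := ?_, v_c_exists := ?_, v_c_unique := ?_, vi := ?_,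
      vii_a := ?_, vii_b := ?_ }
  · -- (i)(a): the hull of a Frobenius-trivial object over `A₀`
    intro A₀
    obtain ⟨A, hA, ⟨i⟩⟩ := hF.i_a A₀
    have hh := isIsotropicHull_hullHom hF A
    haveI : IsIso (Base F (hullHom hF A)) := hh.2.1.2
    exact ⟨hullIstr hF A, (isFrobeniusTrivial_istr_iff hF _).mpr (isFrobeniusTrivial_hull hF hh hA),
      ⟨(asIso (Base F (hullHom hF A))).symm ≪≫ i⟩⟩
  · -- (i)(b): push the common source to its hull
    intro A B α
    change baseObj F A.obj ≅ baseObj F B.obj at α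
    obtain ⟨X, φ, ψ, hφ, hψ, hαφψ⟩ := hF.i_b A.obj B.obj α
    have hk := isIsotropicHull_hullHom hF X
    obtain ⟨φ', hφ', -⟩ := hk.2.2.2 φ A.property
    obtain ⟨ψ', hψ', -⟩ := hk.2.2.2 ψ B.property
    have hφ'p : IsPreStep F φ' := (isPreStep_factors F hP.isTotallyEpimorphic_base
      (show IsPreStep F (hullHom hF X ≫ φ') by rw [hφ']; exact hφ)).1
    have hψ'p : IsPreStep F ψ' := (isPreStep_factors F hP.isTotallyEpimorphic_base
      (show IsPreStep F (hullHom hF X ≫ ψ') by rw [hψ']; exact hψ)).1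
    haveI : IsIso (Base F (hullHom hF X)) := hk.2.1.2
    refine ⟨hullIstr hF X, ObjectProperty.homMk φ', ObjectProperty.homMk ψ', hφ'p, hψ'p, ?_⟩
    show Base F φ' ≫ α.hom = Base F ψ'
    rw [← cancel_epi (Base F (hullHom hF X)), ← Category.assoc, ← base_comp, hφ', hαφψ, ← base_comp,
      hψ']
  · -- (i)(c)
    intro A
    haveI := pullbackSliceToBase_faithful (istrFunctor F) A
    haveI := pullbackSliceToBase_full (istrFunctor F) A
    refine { faithful := inferInstance, full := inferInstance, essSurj := ⟨fun U => ?_⟩ }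
    -- a pull-back morphism of `C` over `U.hom`; its domain is isotropic by Prop. 1.9 (iv)
    haveI := hF.i_c A.obj
    obtain ⟨P, ⟨e⟩⟩ := Functor.EssSurj.mem_essImage (pullbackSliceToBase F A.obj)
      (Over.mk (U.hom : _ ⟶ baseObj F A.obj))
    have hPiso : IsIsotropic F P.left.obj :=
      (isIsotropic_iff_of_isPullbackMorphism hF P.hom.1 P.hom.2).mpr A.property
    let W : Istr F := Istr.mk P.left.obj hPiso
    let ψ : W ⟶ A := ObjectProperty.homMk P.hom.1
    have hψ : IsPullbackMorphism (istrFunctor F) ψ := isPullbackMorphism_istr_of ψ P.hom.2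
    let V : Over (⟨A⟩ : PullbackCat (istrFunctor F)) := Over.mk (Y := ⟨W⟩) ⟨ψ, hψ⟩
    refine ⟨V, ⟨Over.isoMk ((Over.forget _).mapIso e) ?_⟩⟩
    exact Over.w e.hom
  · -- (ii) existence
    intro A n
    obtain ⟨B, φ, hφ, hd⟩ := hF.ii_exists A.obj n
    refine ⟨Istr.mk B (hF.vii_b φ A.property), ObjectProperty.homMk φ,
      (isFrobeniusType_istr_iff hF _).mpr hφ, hd⟩
  · -- (ii) uniqueness
    intro A B B' φ ψ hφ hψ hd
    obtain ⟨β, hβ⟩ := hF.ii_unique φ.hom ψ.hom ((isFrobeniusType_istr_iff hF _).mp hφ)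
      ((isFrobeniusType_istr_iff hF _).mp hψ) hd
    exact ⟨(isotropicObjects F).isoMk β, ObjectProperty.hom_ext _ hβ⟩
  · -- (iii)(a)
    intro X Y Z f g hf hg
    exact (isCoAngular_istr_iff hF _).mpr (hF.iii_a f.hom g.hom ((isCoAngular_istr_iff hF _).mp hf)
      ((isCoAngular_istr_iff hF _).mp hg))
  · -- (iii)(b)
    intro A' A φ hφ ψ
    exact (isCoAngular_istr_iff hF _).mpr
      (hF.iii_b φ.hom ((isCoAngularPreStep_istr_iff hF _).mp hφ) ψ.hom)
  · -- (iii)(c)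
    intro A B φ hφ
    obtain ⟨e, he⟩ := hF.iii_c φ.hom ((isCoAngularPreStep_istr_iff hF _).mp hφ)
    refine ⟨(endSubmonoidIstrEquiv A).trans (e.trans (endSubmonoidIstrEquiv B).symm), fun α => ?_⟩
    apply ObjectProperty.hom_ext
    exact he (endSubmonoidIstrEquiv A α)
  · -- (iii)(c), dependence on `Base(φ)`
    intro A B φ φ' hφ hφ' hb α β β' h h'
    have := hF.iii_c_base φ.hom φ'.hom ((isCoAngularPreStep_istr_iff hF _).mp hφ)
      ((isCoAngularPreStep_istr_iff hF _).mp hφ') hb (endSubmonoidIstrEquiv A α)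
      (endSubmonoidIstrEquiv B β) (endSubmonoidIstrEquiv B β')
      (congrArg InducedCategory.Hom.hom h) (congrArg InducedCategory.Hom.hom h')
    exact (endSubmonoidIstrEquiv B).injective this
  · -- (iii)(d) coslice, full
    intro A B B' φ φ' hφ hφ' hdvd
    obtain ⟨f, hf, hfac⟩ := hF.iii_d_under_full φ.hom φ'.hom
      ((isCoAngularPreStep_istr_iff hF _).mp hφ) ((isCoAngularPreStep_istr_iff hF _).mp hφ') hdvd
    exact ⟨ObjectProperty.homMk f, (isCoAngularPreStep_istr_iff hF _).mpr hf,
      ObjectProperty.hom_ext _ hfac⟩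
  · -- (iii)(d) coslice, essentially surjective
    intro A x
    obtain ⟨B, φ, hφ, hx⟩ := hF.iii_d_under_surj A.obj x
    exact ⟨Istr.mk B (hF.vii_b φ A.property), ObjectProperty.homMk φ,
      (isCoAngularPreStep_istr_iff hF _).mpr hφ, hx⟩
  · -- (iii)(d) slice, full
    intro A B B' ψ ψ' hψ hψ' hdvd
    obtain ⟨g, hg, hfac⟩ := hF.iii_d_over_full ψ.hom ψ'.hom
      ((isCoAngularPreStep_istr_iff hF _).mp hψ) ((isCoAngularPreStep_istr_iff hF _).mp hψ') hdvd
    exact ⟨ObjectProperty.homMk g, (isCoAngularPreStep_istr_iff hF _).mpr hg,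
      ObjectProperty.hom_ext _ hfac⟩
  · -- (iii)(d) slice, essentially surjective (the source is isotropic by Prop. 1.9 (iv))
    intro A x
    obtain ⟨B, ψ, hψ, hx⟩ := hF.iii_d_over_surj A.obj x
    have hB : IsIsotropic F B :=
      (isIsotropic_iff_of_isCoAngular_isLinear hF ψ hψ.1 hψ.2.1).mpr A.property
    exact ⟨Istr.mk B hB, ObjectProperty.homMk ψ, (isCoAngularPreStep_istr_iff hF _).mpr hψ, hx⟩
  · -- (iv)(a) existence
    intro A B φ
    obtain ⟨X, Y, γ, β, α, hfac, hγ, hβ, hα⟩ := hF.iv_a_exists φ.hom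
    have hX : IsIsotropic F X := hF.vii_b γ A.property
    have hY : IsIsotropic F Y := hF.vii_b (γ ≫ β) A.property
    refine ⟨Istr.mk X hX, Istr.mk Y hY, ObjectProperty.homMk γ, ObjectProperty.homMk β,
      ObjectProperty.homMk α, ObjectProperty.hom_ext _ hfac, (isFrobeniusType_istr_iff hF _).mpr hγ,
      hβ, isPullbackMorphism_istr_of _ hα⟩
  · -- (iv)(a) uniqueness
    intro A B X Y X' Y' φ γ β α γ' β' α' hfac hγ hβ hα hfac' hγ' hβ' hα'
    obtain ⟨ε, δ, h1, h2, h3⟩ := hF.iv_a_unique φ.hom γ.hom β.hom α.hom γ'.hom β'.hom α'.hom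
      (congrArg InducedCategory.Hom.hom hfac) ((isFrobeniusType_istr_iff hF _).mp hγ) hβ
      (isPullbackMorphism_of_istr hF _ hα) (congrArg InducedCategory.Hom.hom hfac')
      ((isFrobeniusType_istr_iff hF _).mp hγ') hβ' (isPullbackMorphism_of_istr hF _ hα')
    exact ⟨(isotropicObjects F).isoMk ε, (isotropicObjects F).isoMk δ, ObjectProperty.hom_ext _ h1,
      ObjectProperty.hom_ext _ h2, ObjectProperty.hom_ext _ h3⟩
  · -- (iv)(b)
    intro A B φ hφ
    obtain ⟨hlb, hlin⟩ := hF.iv_b φ.hom (isPullbackMorphism_of_istr hF φ hφ)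
    exact ⟨(isLBInvertible_istr_iff hF _).mpr hlb, hlin⟩
  · -- (v)(a)
    intro A B φ hφ
    haveI := hF.v_a φ.hom hφ
    exact ⟨fun g h hgh => ObjectProperty.hom_ext _
      ((cancel_mono φ.hom).mp (congrArg InducedCategory.Hom.hom hgh))⟩
  · -- (v)(b) existence
    intro A B φ hφ
    obtain ⟨X, β, α, hfac, hβ, hα⟩ := hF.v_b_exists φ.hom hφ
    refine ⟨Istr.mk X (hF.vii_b β A.property), ObjectProperty.homMk β, ObjectProperty.homMk α,
      ObjectProperty.hom_ext _ hfac, (isCoAngularPreStep_istr_iff hF _).mpr hβ, hα⟩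
  · -- (v)(b) uniqueness
    intro A B X X' φ β α β' α' hfac hβ hα hfac' hβ' hα'
    obtain ⟨γ, h1, h2⟩ := hF.v_b_unique φ.hom β.hom α.hom β'.hom α'.hom
      (congrArg InducedCategory.Hom.hom hfac) ((isCoAngularPreStep_istr_iff hF _).mp hβ) hα
      (congrArg InducedCategory.Hom.hom hfac') ((isCoAngularPreStep_istr_iff hF _).mp hβ') hα'
    exact ⟨(isotropicObjects F).isoMk γ, ObjectProperty.hom_ext _ h1, ObjectProperty.hom_ext _ h2⟩
  · -- (v)(c) existence
    intro A B φ hφ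
    obtain ⟨X, β', α', hfac, hβ', hα'⟩ := hF.v_c_exists φ.hom hφ
    refine ⟨Istr.mk X (hF.vii_b β' A.property), ObjectProperty.homMk β', ObjectProperty.homMk α',
      ObjectProperty.hom_ext _ hfac, hβ', (isCoAngularPreStep_istr_iff hF _).mpr hα'⟩
  · -- (v)(c) uniqueness
    intro A B X X' φ β α β' α' hfac hβ hα hfac' hβ' hα'
    obtain ⟨γ, h1, h2⟩ := hF.v_c_unique φ.hom β.hom α.hom β'.hom α'.hom
      (congrArg InducedCategory.Hom.hom hfac) hβ ((isCoAngularPreStep_istr_iff hF _).mp hα)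
      (congrArg InducedCategory.Hom.hom hfac') hβ' ((isCoAngularPreStep_istr_iff hF _).mp hα')
    exact ⟨(isotropicObjects F).isoMk γ, ObjectProperty.hom_ext _ h1, ObjectProperty.hom_ext _ h2⟩
  · -- (vi)
    intro A B φ ψ hφ hψ hb hm
    obtain ⟨α, hα, hfac⟩ := hF.vi φ.hom ψ.hom ((isCoAngularPreStep_istr_iff hF _).mp hφ)
      ((isCoAngularPreStep_istr_iff hF _).mp hψ) hb hm
    exact ⟨(isotropicObjects F).isoMk α, hα, ObjectProperty.hom_ext _ hfac⟩
  · -- (vii)(a): identities are hulls in `C^istr`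
    intro A
    exact ⟨A, 𝟙 A, isIsotropicHull_istr_id A⟩
  · -- (vii)(b): every object of `C^istr` is isotropic
    intro A B _ _
    exact isIsotropic_istr B

end PreFrobenioid

end Literature.AlgebraicGeometry.Frobenioids
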